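import Summits.CriticalPhenomena.PercolationContinuityZ3.Theorems.Transplant.FKDoubleFanSesquiCone
import HarnessLib

/-!
# Double fans `K₂ ∨ P_{m+1}`: the dressed cone — the RIM-CUT endpoint of `Hyp15B` holds (`r = 0`), with an exact `q`-parametric certificate

Helper file (`--supports stmt-CriticalPhenomena-4575`), FK sub-lane `prim-bschramm-fk-3` (gen 42); builds on p205010 (kernel theorem, internal
audit signed; external expert review pending).  No named facts, no sorries; standard axioms.  Memo `bschramm/prim-bschramm-fk-3/FAR-CROSS-XVII.md` §0(D′).

`…SesquiCone` reduces the far cross-apex theorem for all middles to `Hyp15A ∧ Hyp15B`: a rim step `∧²E_r` applied to a DRESSED generator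
(`∧²BC_y·imgA q F w`, resp. `∧²AC_x·imgB q G w`) stays in `cone15 q`.  By the Bernstein split `∧²E_r = r²·I + r(1−r)·T_D + (1−r)²·W_D` the endpoint
`r = 0` is the rank-one operator `W_D β = ℓ_D(β)·(a∧b)` (`opWD`, `formD` of `…Wedge`).  This file proves that endpoint for the `b`-dressed family:
* the cut direction `a∧b = ⟨1,0,0,1,−1,−1,0,0,1,1⟩` is itself an `a`-image (`imgA q (E_0 fanInit) BC_1`, **`abBiv_eq_imgA`**), hence in `cone15 q` (**`abBiv_mem_cone15`**);
  **`opWD_eq_smul_abBiv`**, **`opE_zero_eq_opWD`**;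
* **`formD_opBC_imgA_eq`**: an exact identity `ℓ_D(∧²BC_y·imgA q F w) = Σ` of 54 products (non-negative `q`-factor) × (Bernstein factor in `y`) ×
  (valid form of `F`) × (valid form of `w`) (q-parametric product-form LP, kit j287641, exact rational solve; `ring`), so **`formD_opBC_imgA_nonneg`**
  for `F, w ∈ Valid q`, `0 ≤ q ≤ 1`, `y ∈ [0,1]`;
* hence **`hyp15B_rim_zero`**: `∧²E_0 (∧²BC_y·imgA q F w) ∈ cone15 q` for `F, w ∈ InS q` — the `r = 0` instance of `Hyp15B q` (`0 < q ≤ 1`).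
The `a`-dressed endpoint `ℓ_D(∧²AC_x·imgB q G w) ≥ 0` has exact product-form certificates at each tested rational `q` (kit j287573/j287575: 161/163 terms
at `q = 2/5, 1/20`) but no `q`-polynomial one in the basis tried (j287676/77) — left open here.  The mixed term `T_D` is the remaining content of `Hyp15`.
[folklore]
-/

noncomputable section

namespace Summit.CriticalPhenomena.PercolationContinuityZ3.Theorems

namespace FK

namespace ThreeApex

/-! ### The cut direction `a ∧ b` -/

/-- `W_D β = ℓ_D(β)·(a∧b)`. [folklore] -/
theorem opWD_eq_smul_abBiv (q : ℝ) (β : Biv) : opWD q β = Biv.smul (formD q β) (⟨1, 0, 0, 1, -1, -1, 0, 0, 1, 1⟩ : Biv) := by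
  ext <;> simp [opWD, Biv.smul]

/-- `∧²E_0 = W_D` (the rim step with weight `0` is the cut). [folklore] -/
theorem opE_zero_eq_opWD (q : ℝ) (β : Biv) : opE q 0 β = opWD q β := by
  ext <;> simp [opE, Biv.lin3, Biv.add, Biv.smul]

/-- **`a ∧ b` is an `a`-image**: the input pair of `BC_1` pushed through the cut gadget `E_0 fanInit = (1,0,0,0,0)`. [folklore] -/
theorem abBiv_eq_imgA (q : ℝ) : (⟨1, 0, 0, 1, -1, -1, 0, 0, 1, 1⟩ : Biv) = imgA q (rimStep q 0 fanInit) (edgeBC 1) := by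
  rw [fanInit_eq]
  ext <;> norm_num [imgA, fanCombo, wedgeH, conv, edgeAC, edgeBC, detach, rimStep, hx, hy, hz, V5.total]

/-- **`a ∧ b ∈ cone15 q`** (`0 < q ≤ 1`). [folklore] -/
theorem abBiv_mem_cone15 {q : ℝ} (hq0 : 0 < q) (hq1 : q ≤ 1) : (⟨1, 0, 0, 1, -1, -1, 0, 0, 1, 1⟩ : Biv) ∈ cone15 q := by
  rw [abBiv_eq_imgA q]
  exact imgA_mem_cone15 ((InKE.rim le_rfl zero_le_one (fanInit_inKE q)).inS hq0 hq1) ((IsLetter.bc zero_le_one le_rfl).inS hq0 hq1)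

/-- Non-negative multiples of cone elements are cone elements. [folklore] -/
theorem smul_mem_cone15 {q : ℝ} {β : Biv} (hβ : β ∈ cone15 q) {a : ℝ} (ha : 0 ≤ a) : Biv.smul a β ∈ cone15 q :=
  fun γ hγ => by rw [pairH_smul_left]; exact mul_nonneg ha (hβ γ hγ)

/-! ### The certificate: `ℓ_D ≥ 0` on the `b`-dressed `a`-images -/

/-- **Exact identity** for `ℓ_D(∧²BC_y·imgA q F w)` as a non-negative combination of products of valid forms (54 terms). [folklore] -/
theorem formD_opBC_imgA_eq (q y : ℝ) (F w : V5) :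
    formD q (opBC y (imgA q F w)) =
        masterN q F * masterN q (swapAB w)
        + (1 : ℝ) / 2 * (2 - q) ^ 2 * y * masterN q F * kap (swapAB w)
        + (1 : ℝ) / 4 * (2 - q) ^ 2 * y * kap F * masterN q (swapAB w)
        + (1 : ℝ) / 4 * (2 - q) ^ 2 * y * kap (swapAB F) * masterN q (swapAB w)
        + (1 : ℝ) / 4 * (2 - q) ^ 2 * (1 - y) * masterN q (swapAB F) * masterN q (swapAB w)
        + (1 : ℝ) / 4 * (2 - q) ^ 2 * y ^ 2 * (F.z0 * F.z0) * masterN q (swapAB w)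
        + (1 : ℝ) / 4 * (2 - q) ^ 2 * y ^ 2 * (F.z0 * F.zab) * masterN q (swapAB w)
        + (1 : ℝ) / 4 * (2 - q) ^ 2 * y ^ 2 * (F.z0 * F.zac) * masterN q (swapAB w)
        + (1 : ℝ) / 4 * (2 - q) ^ 2 * y ^ 2 * (F.zab * F.zac) * masterN q (swapAB w)
        + (1 : ℝ) / 4 * (2 - q) ^ 2 * y ^ 2 * masterN q F * (w.z0 * w.z0)
        + (1 : ℝ) / 4 * (2 - q) ^ 2 * y ^ 2 * masterN q F * (w.z0 * w.zab)
        + (1 : ℝ) / 4 * (2 - q) ^ 2 * y ^ 2 * masterN q F * (w.z0 * w.zac)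
        + (1 : ℝ) / 4 * (2 - q) ^ 2 * y ^ 2 * masterN q F * (w.zab * w.zac)
        + (1 : ℝ) / 4 * (2 - q) ^ 2 * y * (1 - y) * kap F * masterN q (swapAB w)
        + (1 : ℝ) / 4 * (2 - q) ^ 2 * y * (1 - y) * kap (swapAB F) * masterN q (swapAB w)
        + (1 : ℝ) / 2 * (2 - q) ^ 2 * (1 - y) ^ 2 * (F.zac * F.zbc) * masterN q (swapAB w)
        + (1 : ℝ) / 2 * (2 - q) ^ 2 * (1 - y) ^ 2 * lam F * masterN q (swapAB w)
        + (1 : ℝ) / 2 * q * (F.zab * F.zbc) * masterN q (swapAB w)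
        + (1 : ℝ) / 2 * q * y * masterN q F * (w.z0 * w.z0)
        + (1 : ℝ) / 2 * q * y * masterN q F * (w.z0 * w.zac)
        + (1 : ℝ) / 2 * q * y * masterN q F * (w.zab * w.zac)
        + (1 : ℝ) / 2 * q * (1 - y) * masterN q (swapAB F) * masterN q (swapAB w)
        + (1 : ℝ) / 2 * q * (2 - q) * (F.z0 * F.zbc) * masterN q (swapAB w)
        + (1 : ℝ) / 4 * q * (2 - q) * (F.zab * F.zbc) * masterN q (swapAB w)
        + (1 : ℝ) / 2 * q * (2 - q) * kap F * masterN q (swapAB w)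
        + (1 : ℝ) / 2 * q * (2 - q) * y * (F.z0 * F.z0) * masterN q (swapAB w)
        + (1 : ℝ) / 2 * q * (2 - q) * y * (F.z0 * F.zab) * masterN q (swapAB w)
        + (1 : ℝ) / 4 * q * (2 - q) * y * masterN q F * (w.z0 * w.z0)
        + (1 : ℝ) / 2 * q * (2 - q) * y * masterN q F * (w.z0 * w.zab)
        + (1 : ℝ) / 4 * q * (2 - q) * y * masterN q F * (w.z0 * w.zac)
        + (1 : ℝ) / 4 * q * (2 - q) * y * masterN q F * (w.zab * w.zac)
        + (1 : ℝ) / 2 * q * (2 - q) * y * masterN q F * kap (swapAB w)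
        + (1 : ℝ) / 4 * q * (2 - q) * (1 - y) * masterN q (swapAB F) * masterN q (swapAB w)
        + (1 : ℝ) / 2 * q * (2 - q) * y * (1 - y) * (F.z0 * F.z0) * masterN q (swapAB w)
        + (1 : ℝ) / 2 * q * (2 - q) * y * (1 - y) * (F.z0 * F.zab) * masterN q (swapAB w)
        + (1 : ℝ) / 4 * q ^ 2 * (F.z0 * F.z0) * masterN q (swapAB w)
        + (1 : ℝ) / 4 * q ^ 2 * (F.z0 * F.zab) * masterN q (swapAB w)
        + (1 : ℝ) / 4 * q ^ 2 * (F.z0 * F.zbc) * masterN q (swapAB w)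
        + (1 : ℝ) / 4 * q ^ 2 * y * masterN q F * (w.z0 * w.zab)
        + (1 : ℝ) / 2 * q ^ 2 * (1 - y) * (F.z0 * F.z0) * masterN q (swapAB w)
        + (1 : ℝ) / 2 * q ^ 2 * (1 - y) * (F.z0 * F.zab) * masterN q (swapAB w)
        + (1 : ℝ) / 2 * q ^ 2 * (1 - y) * (F.z0 * F.zac) * masterN q (swapAB w)
        + (1 : ℝ) / 2 * q ^ 2 * (1 - y) * (F.zab * F.zac) * masterN q (swapAB w)
        + (1 : ℝ) / 4 * q ^ 2 * y * (1 - y) * masterN q F * (w.z0 * w.z0)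
        + (1 : ℝ) / 4 * q ^ 2 * y * (1 - y) * masterN q F * (w.z0 * w.zab)
        + (1 : ℝ) / 4 * q ^ 2 * y * (1 - y) * masterN q F * (w.z0 * w.zac)
        + (1 : ℝ) / 4 * q ^ 2 * y * (1 - y) * masterN q F * (w.zab * w.zac)
        + (1 : ℝ) / 4 * q ^ 2 * (1 - y) ^ 2 * (F.z0 * F.z0) * masterN q (swapAB w)
        + (1 : ℝ) / 4 * q ^ 2 * (1 - y) ^ 2 * (F.z0 * F.zab) * masterN q (swapAB w)
        + (1 : ℝ) / 4 * q ^ 2 * (1 - y) ^ 2 * (F.z0 * F.zbc) * masterN q (swapAB w)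
        + (1 : ℝ) / 4 * q ^ 2 * (1 - y) ^ 2 * (F.zab * F.zbc) * masterN q (swapAB w)
        + (1 - q) * (2 - q) * y ^ 2 * kap F * kap (swapAB w)
        + (1 - q) * (2 - q) * y * (1 - y) * (F.zac * F.zbc) * kap (swapAB w)
        + (1 - q) * (2 - q) * y * (1 - y) * lam F * kap (swapAB w) := by
  simp only [formD, opBC, opTb, opWb, Biv.lin3, Biv.add, Biv.smul, imgA, fanCombo, wedgeH, conv, edgeAC, detach, hx, hy, hz, V5.total,
    masterN, lam, kap, swapAB]
  ring

/-- **`ℓ_D(∧²BC_y·imgA q F w) ≥ 0`** for `F, w ∈ Valid q`, `0 ≤ q ≤ 1`, `y ∈ [0,1]`. [folklore] -/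
theorem formD_opBC_imgA_nonneg {q y : ℝ} (hq0 : 0 ≤ q) (hq1 : q ≤ 1) (hy0 : 0 ≤ y) (hy1 : y ≤ 1) {F w : V5} (hF : Valid q F)
    (hw : Valid q w) : 0 ≤ formD q (opBC y (imgA q F w)) := by
  obtain ⟨⟨hF0, hFab, hFac, hFbc, hF1⟩, hFN, hFNab, hFNbc, hFL, hFk, hFkb, hFkc⟩ := hF
  obtain ⟨⟨hw0, hwab, hwac, hwbc, hw1⟩, hwN, hwNab, hwNbc, hwL, hwk, hwkb, hwkc⟩ := hw
  have hp : 0 ≤ 1 - q := by linarith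
  have hr : 0 ≤ 2 - q := by linarith
  have hy' : 0 ≤ 1 - y := by linarith
  rw [formD_opBC_imgA_eq]
  positivity

/-! ### The rim-cut endpoint of `Hyp15B` -/

/-- **`Hyp15B` at `r = 0`**: cutting the rim after the first `b`-spoke on an `a`-image lands in the dressed cone (`0 < q ≤ 1`). [folklore] -/
theorem hyp15B_rim_zero {q : ℝ} (hq0 : 0 < q) (hq1 : q ≤ 1) {F w : V5} (hF : InS q F) (hw : InS q w) {y : ℝ} (hy0 : 0 ≤ y) (hy1 : y ≤ 1) :
    opE q 0 (opBC y (imgA q F w)) ∈ cone15 q := by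
  rw [opE_zero_eq_opWD, opWD_eq_smul_abBiv]
  exact smul_mem_cone15 (abBiv_mem_cone15 hq0 hq1) (formD_opBC_imgA_nonneg hq0.le hq1 hy0 hy1 hF.valid hw.valid)

end ThreeApex

end FK

end Summit.CriticalPhenomena.PercolationContinuityZ3.Theorems
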